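import Mathlib
import Summits.KontsevichZagierPeriods.Zeta5Search.DenomLaw.ThresholdModelCensus

/-!
# ζ(5) search — DENOM-LAW: the threshold model, PART II (the level census), part B: the excess formula `excess = excessFormula` (Theorem S (i)/(i′) level by level)

Cell `pub-zeta5`, track DENOM-LAW (K1 typing order item (1), «ThresholdModel port»): denom-engine-d2 g12's kernel-checked scratch module
`denom-law/engine-d2/g12/lean/LevelCensus.lean` PART II (THRESHOLD-X4; Theorem S (i)/(i′) at cell level) filed VERBATIM in four parts
(≤ 400 lines each; split plan THRESHOLD-X4 §2; docstrings added where the scratch file had none) by denom-prover-d1 g5.  Part B of 4.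
HONEST FRAMING: systematic search; MODEL/structure side — elementary integer arithmetic of the level census; nothing about ζ(5); no γ; no irrationality claim; records in print UNMOVED.
The mathematical header of PART II (the census, what is proved) is the second module docstring of part A (`ThresholdModelCensus.lean`).
-/

namespace Summit.KontsevichZagierPeriods.Zeta5Search.DenomLaw.ThresholdModel.Rho

section Table
variable {p R0 m : ℤ} {r : Fin 7 → ℤ} {ℓ u : ℤ}

/-- `indic True = 1`. -/
theorem indic_true' : indic True = 1 := indic_pos trivial
/-- `indic False = 0`. -/
theorem indic_false' : indic False = 0 := indic_neg not_false

/-- `Σ_j (1 − g j) = 7 − Σ_j g j` over the seven blocks. -/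
theorem sum_one_sub (g : Fin 7 → ℤ) : (∑ j : Fin 7, (1 - g j)) = 7 - ∑ j : Fin 7, g j := by
  rw [Finset.sum_sub_distrib]; simp

/-- On the pole frame `T = 6`. -/
theorem Tsym_pole (h0 : m - 1 ≤ ℓ) (h1 : ℓ ≤ 2 * m - 1) : Tsym m ℓ = 6 := by
  unfold Tsym; rw [if_pos ⟨h0, h1⟩]

/-- On the lower zero frame `T = −1`. -/
theorem Tsym_zeroLo (h0 : 0 ≤ ℓ) (h1 : ℓ ≤ m - 2) : Tsym m ℓ = -1 := by
  unfold Tsym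
  rw [if_neg (show ¬(m - 1 ≤ ℓ ∧ ℓ ≤ 2 * m - 1) by omega), if_pos (Or.inl ⟨h0, h1⟩)]

/-- On the upper zero frame `T = −1`. -/
theorem Tsym_zeroHi (h0 : 2 * m ≤ ℓ) (h1 : ℓ ≤ 3 * m - 2) : Tsym m ℓ = -1 := by
  unfold Tsym
  rw [if_neg (show ¬(m - 1 ≤ ℓ ∧ ℓ ≤ 2 * m - 1) by omega), if_pos (Or.inr ⟨h0, h1⟩)]

/-- Outside `[0, 3m − 2]` we have `T = 0`. -/
theorem Tsym_outside (hm : 1 ≤ m) (hℓ : ℓ ≤ -1 ∨ 3 * m - 1 ≤ ℓ) : Tsym m ℓ = 0 := by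
  unfold Tsym
  rw [if_neg (show ¬(m - 1 ≤ ℓ ∧ ℓ ≤ 2 * m - 1) by omega),
    if_neg (show ¬((0 ≤ ℓ ∧ ℓ ≤ m - 2) ∨ (2 * m ≤ ℓ ∧ ℓ ≤ 3 * m - 2)) by omega)]

/-- `T` is mirror-invariant. -/
theorem Tsym_mirror (m ℓ : ℤ) : Tsym m (3 * m - 2 - ℓ) = Tsym m ℓ := by
  unfold Tsym
  by_cases h1 : m - 1 ≤ ℓ ∧ ℓ ≤ 2 * m - 1
  · rw [if_pos h1, if_pos (by omega)]
  · rw [if_neg h1, if_neg (by omega)]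
    by_cases h2 : (0 ≤ ℓ ∧ ℓ ≤ m - 2) ∨ (2 * m ≤ ℓ ∧ ℓ ≤ 3 * m - 2)
    · rw [if_pos h2, if_pos (by omega)]
    · rw [if_neg h2, if_neg (by omega)]

/-- The number of covering blocks is mirror-invariant. -/
theorem nBlocks_mirror (p m : ℤ) (r : Fin 7 → ℤ) (ℓ u : ℤ) : nBlocks p m r (3 * m - 2 - ℓ) (-u) = nBlocks p m r ℓ u :=
  Finset.sum_congr rfl (fun j _ => indic_congr (blockCov_mirror p m (r j) ℓ u))

/-- `ord` is mirror-invariant. -/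
theorem ord_mirror (p R0 m : ℤ) (r : Fin 7 → ℤ) (ℓ u : ℤ) : ord p R0 m r (3 * m - 2 - ℓ) (-u) = ord p R0 m r ℓ u := by
  unfold ord; rw [nBlocks_mirror, indic_congr (numCov_mirror p m R0 ℓ u)]

/-- **MIRROR SYMMETRY of the census**: `E(3m−2−ℓ, −u) = E(ℓ, u)` (the class `−u` is the mirror class `x̄`; S3c at level resolution). -/
theorem excess_mirror (p R0 m : ℤ) (r : Fin 7 → ℤ) (ℓ u : ℤ) : excess p R0 m r (3 * m - 2 - ℓ) (-u) = excess p R0 m r ℓ u := by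
  unfold excess; rw [Tsym_mirror, ord_mirror]

/-- off `[−1, 3m−1]` no block and no numerator term: `ord = 0`. -/
theorem ord_outside (h : LevelBox p R0 r) (hm : 1 ≤ m) (hu1 : -p ≤ u) (hu2 : u ≤ p) (hℓ : ℓ ≤ -2 ∨ 3 * m ≤ ℓ) :
    nBlocks p m r ℓ u = 0 ∧ ord p R0 m r ℓ u = 0 := by
  have key : ∀ ρ, ρ ≤ R0 + p → ¬ BlockCov p m ρ ℓ u ∧ ¬ NumCov p m R0 ℓ u := fun ρ hρ => by
    rcases hℓ with hℓ | hℓ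
    · exact cov_below h.one_le_p h.R0_lt hρ hm hu1 hℓ
    · exact cov_above h.one_le_p h.R0_lt hρ hm hu2 hℓ
  have hB : nBlocks p m r ℓ u = 0 := by
    unfold nBlocks
    exact Finset.sum_eq_zero (fun j _ => indic_neg (key (r j) (h.r_le j)).1)
  refine ⟨hB, ?_⟩
  unfold ord; rw [hB, indic_neg (key R0 (by linarith [h.one_le_p])).2]; ring

/-- off `[−1, 3m−1]` the excess vanishes. -/
theorem excess_outside (h : LevelBox p R0 r) (hm : 1 ≤ m) (hu1 : -p ≤ u) (hu2 : u ≤ p) (hℓ : ℓ ≤ -2 ∨ 3 * m ≤ ℓ) :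
    excess p R0 m r ℓ u = 0 := by
  unfold excess; rw [(ord_outside h hm hu1 hu2 hℓ).2, Tsym_outside hm (by omega)]; ring

/-- **LEVEL −1** (`ζ = −3m/2`): `E = n₋(u) − [m = 1]·#{j : ρ_j ≥ 3p+u}` (the printed `n₋`, minus A1 at `m = 1`). -/
theorem excess_bottom (h : LevelBox p R0 r) (hm : 1 ≤ m) (hu1 : -p ≤ u) :
    excess p R0 m r (-1) u = nm p R0 u - (if m = 1 then reachL p r u else 0) := by
  have hp := h.one_le_p
  have hB : nBlocks p m r (-1) u = (if m = 1 then reachL p r u else 0) := by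
    unfold nBlocks reachL countGe
    by_cases hm1 : m = 1
    · rw [if_pos hm1]
      exact Finset.sum_congr rfl (fun j _ => indic_congr (by
        rw [blockCov_bottom_iff hp (h.r_le j) h.R0_lt hm hu1]; exact ⟨fun hh => hh.2, fun hh => ⟨hm1, hh⟩⟩))
    · rw [if_neg hm1]
      exact Finset.sum_eq_zero (fun j _ => indic_neg (by
        rw [blockCov_bottom_iff hp (h.r_le j) h.R0_lt hm hu1]; exact fun hh => hm1 hh.1))
  have hN : indic (NumCov p m R0 (-1) u) = nm p R0 u := by
    unfold nm; exact indic_congr (numCov_bottom_iff hp hm hu1)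
  unfold excess ord; rw [hB, hN, Tsym_outside hm (Or.inl le_rfl)]; ring

/-- **LOWER ZERO FRAME** `0 ≤ ℓ ≤ m−2` (`m ≥ 2`): `E = −[ℓ = 0]·[u > R₀] − [ℓ = m−2]·#{j : ρ_j ≥ 3p+u}` (≤ 0: inadmissibility lives here). -/
theorem excess_zeroLo (h : LevelBox p R0 r) (hu1 : -p ≤ u) (hu2 : u ≤ p) (h0 : 0 ≤ ℓ) (h1 : ℓ ≤ m - 2) :
    excess p R0 m r ℓ u = -(if ℓ = 0 then indic (R0 < u) else 0) - (if ℓ = m - 2 then reachL p r u else 0) := by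
  have hp := h.one_le_p
  have hB : nBlocks p m r ℓ u = (if ℓ = m - 2 then reachL p r u else 0) := by
    unfold nBlocks reachL countGe
    by_cases h2 : ℓ = m - 2
    · rw [if_pos h2]
      exact Finset.sum_congr rfl (fun j _ => indic_congr (by
        rw [blockCov_zeroLo_iff hp (h.r_le j) h.R0_lt hu1 h0 h1]; exact ⟨fun hh => hh.2, fun hh => ⟨h2, hh⟩⟩))
    · rw [if_neg h2]
      exact Finset.sum_eq_zero (fun j _ => indic_neg (by
        rw [blockCov_zeroLo_iff hp (h.r_le j) h.R0_lt hu1 h0 h1]; exact fun hh => h2 hh.1))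
  have hN : indic (NumCov p m R0 ℓ u) = 1 - (if ℓ = 0 then indic (R0 < u) else 0) := by
    rw [indic_congr (numCov_zeroLo_iff hp h.R0_nonneg hu1 hu2 h0 h1)]
    by_cases h2 : ℓ = 0
    · rw [if_pos h2]; unfold indic; split_ifs <;> omega
    · rw [if_neg h2, indic_pos (Or.inl (by omega))]; ring
  unfold excess ord; rw [hB, hN, Tsym_zeroLo h0 h1]; ring

/-- **LOWER POLE EDGE** `ℓ = m−1` (`ζ = −m/2`): `E = L(u) − [m = 1]·[u > R₀]` (Theorem S (i); A2 at `m = 1`). -/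
theorem excess_lowEdge (h : LevelBox p R0 r) (hm : 1 ≤ m) (hu1 : -p ≤ u) (hu2 : u ≤ p) :
    excess p R0 m r (m - 1) u = L p r u - (if m = 1 then indic (R0 < u) else 0) := by
  have hp := h.one_le_p
  have hB : nBlocks p m r (m - 1) u = 7 - L p r u := by
    unfold nBlocks L countLt
    rw [← sum_one_sub]
    exact Finset.sum_congr rfl (fun j _ => by
      rw [indic_congr (blockCov_lowEdge_iff (ρ := r j) hp hm hu1)]; unfold indic; split_ifs <;> omega)
  have hN : indic (NumCov p m R0 (m - 1) u) = 1 - (if m = 1 then indic (R0 < u) else 0) := by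
    rw [indic_congr (numCov_lowEdge_iff hp h.R0_nonneg hm hu1 hu2)]
    by_cases h2 : m = 1
    · rw [if_pos h2]; unfold indic; split_ifs <;> omega
    · rw [if_neg h2, indic_pos (Or.inl (by omega))]; ring
  unfold excess ord; rw [hB, hN, Tsym_pole le_rfl (by omega)]; ring

/-- **INTERIOR POLE LEVELS** `m ≤ ℓ ≤ 2m−2`: all seven blocks and the numerator cover, `E = 6 − (7 − 1) = 0`. -/
theorem excess_interior (h : LevelBox p R0 r) (hu1 : -p ≤ u) (hu2 : u ≤ p) (h0 : m ≤ ℓ) (h1 : ℓ ≤ 2 * m - 2) :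
    excess p R0 m r ℓ u = 0 := by
  have hp := h.one_le_p
  have hB : nBlocks p m r ℓ u = 7 := by
    unfold nBlocks
    rw [Finset.sum_congr rfl (fun j _ => indic_pos (cov_interior hp (h.r_nonneg j) h.R0_nonneg hu1 hu2 h0 h1).1)]
    simp
  have hN : indic (NumCov p m R0 ℓ u) = 1 := indic_pos (cov_interior hp (h.r_nonneg 0) h.R0_nonneg hu1 hu2 h0 h1).2
  unfold excess ord; rw [hB, hN, Tsym_pole (by omega) (by omega)]; ring

/-- **UPPER POLE EDGE** `ℓ = 2m−1` (`ζ = +m/2`): `E = R(u) − [m = 1]·[u < −R₀]`. -/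
theorem excess_highEdge (h : LevelBox p R0 r) (hm : 1 ≤ m) (hu1 : -p ≤ u) (hu2 : u ≤ p) :
    excess p R0 m r (2 * m - 1) u = R p r u - (if m = 1 then indic (u < -R0) else 0) := by
  have hp := h.one_le_p
  have hB : nBlocks p m r (2 * m - 1) u = 7 - R p r u := by
    unfold nBlocks R countLt
    rw [← sum_one_sub]
    exact Finset.sum_congr rfl (fun j _ => by
      rw [indic_congr (blockCov_highEdge_iff (ρ := r j) hp hm hu2)]; unfold indic; split_ifs <;> omega)
  have hN : indic (NumCov p m R0 (2 * m - 1) u) = 1 - (if m = 1 then indic (u < -R0) else 0) := by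
    rw [indic_congr (numCov_highEdge_iff hp h.R0_nonneg hm hu1 hu2)]
    by_cases h2 : m = 1
    · rw [if_pos h2]; unfold indic; split_ifs <;> omega
    · rw [if_neg h2, indic_pos (Or.inl (by omega))]; ring
  unfold excess ord; rw [hB, hN, Tsym_pole (by omega) le_rfl]; ring

/-- **UPPER ZERO FRAME** `2m ≤ ℓ ≤ 3m−2`: `E = −[ℓ = 3m−2]·[u < −R₀] − [ℓ = 2m]·#{j : ρ_j ≥ 3p−u}`. -/
theorem excess_zeroHi (h : LevelBox p R0 r) (hu1 : -p ≤ u) (hu2 : u ≤ p) (h0 : 2 * m ≤ ℓ) (h1 : ℓ ≤ 3 * m - 2) :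
    excess p R0 m r ℓ u = -(if ℓ = 3 * m - 2 then indic (u < -R0) else 0) - (if ℓ = 2 * m then reachR p r u else 0) := by
  have hp := h.one_le_p
  have hB : nBlocks p m r ℓ u = (if ℓ = 2 * m then reachR p r u else 0) := by
    unfold nBlocks reachR countGe
    by_cases h2 : ℓ = 2 * m
    · rw [if_pos h2]
      exact Finset.sum_congr rfl (fun j _ => indic_congr (by
        rw [blockCov_zeroHi_iff hp (h.r_le j) h.R0_lt hu2 h0 h1]; exact ⟨fun hh => hh.2, fun hh => ⟨h2, hh⟩⟩))
    · rw [if_neg h2]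
      exact Finset.sum_eq_zero (fun j _ => indic_neg (by
        rw [blockCov_zeroHi_iff hp (h.r_le j) h.R0_lt hu2 h0 h1]; exact fun hh => h2 hh.1))
  have hN : indic (NumCov p m R0 ℓ u) = 1 - (if ℓ = 3 * m - 2 then indic (u < -R0) else 0) := by
    rw [indic_congr (numCov_zeroHi_iff hp h.R0_nonneg hu1 hu2 h0 h1)]
    by_cases h2 : ℓ = 3 * m - 2
    · rw [if_pos h2]; unfold indic; split_ifs <;> omega
    · rw [if_neg h2, indic_pos (Or.inl (by omega))]; ring
  unfold excess ord; rw [hB, hN, Tsym_zeroHi h0 h1]; ring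

/-- **LEVEL 3m−1** (`ζ = +3m/2`): `E = n₊(u) − [m = 1]·#{j : ρ_j ≥ 3p−u}`. -/
theorem excess_top (h : LevelBox p R0 r) (hm : 1 ≤ m) (hu2 : u ≤ p) :
    excess p R0 m r (3 * m - 1) u = np p R0 u - (if m = 1 then reachR p r u else 0) := by
  have hp := h.one_le_p
  have hB : nBlocks p m r (3 * m - 1) u = (if m = 1 then reachR p r u else 0) := by
    unfold nBlocks reachR countGe
    by_cases hm1 : m = 1
    · rw [if_pos hm1]
      exact Finset.sum_congr rfl (fun j _ => indic_congr (by
        rw [blockCov_top_iff hp (h.r_le j) h.R0_lt hm hu2]; exact ⟨fun hh => hh.2, fun hh => ⟨hm1, hh⟩⟩))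
    · rw [if_neg hm1]
      exact Finset.sum_eq_zero (fun j _ => indic_neg (by
        rw [blockCov_top_iff hp (h.r_le j) h.R0_lt hm hu2]; exact fun hh => hm1 hh.1))
  have hN : indic (NumCov p m R0 (3 * m - 1) u) = np p R0 u := by
    unfold np; exact indic_congr (numCov_top_iff hp hm hu2)
  unfold excess ord; rw [hB, hN, Tsym_outside hm (Or.inr le_rfl)]; ring

/-- **THE EXCESS TABLE — one closed form for every octave `m ≥ 1`** (Theorem S (i) for `m ≥ 2` and (i′) = A1/A2 for
`m = 1` at once; no admissibility hypothesis: the negative entries ARE the inadmissibility events). -/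
theorem excess_eq_formula (h : LevelBox p R0 r) (hm : 1 ≤ m) (hu1 : -p ≤ u) (hu2 : u ≤ p) (ℓ : ℤ) :
    excess p R0 m r ℓ u = excessFormula p R0 m r ℓ u := by
  unfold excessFormula
  rcases (show ℓ ≤ -2 ∨ ℓ = -1 ∨ (0 ≤ ℓ ∧ ℓ ≤ m - 2) ∨ ℓ = m - 1 ∨ (m ≤ ℓ ∧ ℓ ≤ 2 * m - 2) ∨ ℓ = 2 * m - 1 ∨
      (2 * m ≤ ℓ ∧ ℓ ≤ 3 * m - 2) ∨ ℓ = 3 * m - 1 ∨ 3 * m ≤ ℓ by omega) with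
    hℓ | hℓ | ⟨h0, h1⟩ | hℓ | ⟨h0, h1⟩ | hℓ | ⟨h0, h1⟩ | hℓ | hℓ
  · rw [excess_outside h hm hu1 hu2 (Or.inl hℓ)]
    simp (disch := omega) only [if_neg]; norm_num
  · rw [show excess p R0 m r ℓ u = excess p R0 m r (-1) u by rw [hℓ], excess_bottom h hm hu1]
    by_cases hm1 : m = 1 <;> simp (disch := omega) only [if_pos, if_neg] <;> ring
  · rw [excess_zeroLo h hu1 hu2 h0 h1]
    by_cases hz : ℓ = 0 <;> by_cases hz' : ℓ = m - 2 <;> simp (disch := omega) only [if_pos, if_neg] <;> ring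
  · rw [show excess p R0 m r ℓ u = excess p R0 m r (m - 1) u by rw [hℓ], excess_lowEdge h hm hu1 hu2]
    by_cases hm1 : m = 1 <;> simp (disch := omega) only [if_pos, if_neg] <;> ring
  · rw [excess_interior h hu1 hu2 h0 h1]
    simp (disch := omega) only [if_neg]; norm_num
  · rw [show excess p R0 m r ℓ u = excess p R0 m r (2 * m - 1) u by rw [hℓ], excess_highEdge h hm hu1 hu2]
    by_cases hm1 : m = 1 <;> simp (disch := omega) only [if_pos, if_neg] <;> ring
  · rw [excess_zeroHi h hu1 hu2 h0 h1]
    by_cases hz : ℓ = 3 * m - 2 <;> by_cases hz' : ℓ = 2 * m <;> simp (disch := omega) only [if_pos, if_neg] <;> ring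
  · rw [show excess p R0 m r ℓ u = excess p R0 m r (3 * m - 1) u by rw [hℓ], excess_top h hm hu2]
    by_cases hm1 : m = 1 <;> simp (disch := omega) only [if_pos, if_neg] <;> ring
  · rw [excess_outside h hm hu1 hu2 (Or.inr hℓ)]
    simp (disch := omega) only [if_neg]; norm_num

end Table

/-! ### Sums over the levels: S3a bookkeeping `Σ_ℓ T_m = 4m+8`, `Σ_ℓ E = δ_A`, `Σ_ℓ ord = 4m+8 − δ_A` -/

end Summit.KontsevichZagierPeriods.Zeta5Search.DenomLaw.ThresholdModel.Rho
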